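import Mathlib.Analysis.Real.Cardinality
import Mathlib.LinearAlgebra.Eigenspace.Triangularizable
import Literature.MathematicalPhysics.QuantumLattice.LTQOProofs
import Literature.MathematicalPhysics.QuantumLattice.HubbardModel

/-!
# Route `BalabanIR`, crux 5 `BirEveryGroundState` (item `stmt-HubbardSuperconductivity-2083`): Schur, chord and coupling-choice lemmas

Finite-dimensional linear algebra serving the intended proofs of the crux average → every
(cards `generic-u-schur-every-gs`, `commutant-schur-pair-invariance`, `kappa-chord-transfer`);
companion of `BalabanIRBirEveryGroundState.lean` (the Hubbard-side reduction). Sorry-free: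

* `minEnergyOn_le_re_rayleigh` — the variational principle in a sector,
  `minEnergyOn A K ≤ re ⟨ψ, A ψ⟩` for unit `ψ ∈ K` (the Rayleigh set is bounded below);
* `chord_div_le_re_expect` (`_of_eigen`) — the chord inequality of card `kappa-chord-transfer`:
  `(minEnergyOn (H + κ Y) K - minEnergyOn H K) / κ ≤ re ⟨ψ, Y ψ⟩` for every normalised `ψ ∈ K` of
  energy `minEnergyOn H K` (one variational step; EVERY sector ground state inherits a bound from
  ONE difference of sector energies);
* `exists_scalar_of_irreducible` — Schur's lemma, operator form: an operator preserving `K` and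
  commuting on `K` with a family of operators under which `K` is irreducible is a scalar on `K`;
* `projMatrix_map_mulVec_comm` — a matrix `X` with `X K ⊆ K`, `Xᴴ K ⊆ K` commutes with the
  orthogonal projection onto `K`;
* `exists_scalar_matrixElements_of_irreducible` — Schur for the compression of an observable `A`
  commuting with such a family of symmetries: irreducibility of `K` makes `⟨w, A v⟩ = μ ⟨w, v⟩` on
  `K` (the input of `birEveryGroundState_of_scalarOnGround` in the companion file);
* `exists_mem_Ioo_forall_not_mem` — countably many countable bad sets of couplings miss a point of
  every open window (the coupling-choice step).

Tasaki (2020) §2.1, App. A.2; Serre, *Linear Representations of Finite Groups* §2.2 (Schur);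
Kato (1966) II §6.1 for the context. Everything is folklore; no definition is introduced.Rev-5 MATERIALISATION RULE of the route: since its 2026-08-16 revision this module imports no
route file (`…Theses.BalabanIR`) and no Theorems module that does, so that Theses-free CLOSING
modules of the crux may import it.
-/

noncomputable section

namespace Summit.HubbardSuperconductivity.HubbardSuperconductivity.Theorems

open Matrix Finset Filter
open Literature.Probability.LatticeModels Literature.MathematicalPhysics.QuantumLattice
open scoped ComplexOrder

/-! ### Variational bookkeeping on a sector: `minEnergyOn ≤` Rayleigh quotient, the chord -/

section Variational

variable {n : Type*} [Fintype n]

/-- Crude lower bound `re ⟨ψ, A ψ⟩ ≥ -Σ_{s,t} |A_{st}|` for a unit vector (finite dimension).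
Tasaki (2020) §2.1. [folklore] -/
theorem neg_sum_norm_le_re_rayleigh (A : Matrix n n ℂ) {ψ : n → ℂ} (hψ : star ψ ⬝ᵥ ψ = 1) :
    -(∑ s, ∑ t, ‖A s t‖) ≤ (star ψ ⬝ᵥ A *ᵥ ψ).re := by
  have hcomp : ∀ s, ‖ψ s‖ ≤ 1 := by
    intro s
    have h1 : ‖ψ s‖ ^ 2 ≤ ∑ t, ‖ψ t‖ ^ 2 :=
      Finset.single_le_sum (fun t _ => sq_nonneg (‖ψ t‖)) (mem_univ s)
    have h2 : (∑ t, ‖ψ t‖ ^ 2 : ℝ) = 1 := by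
      have := congrArg Complex.re hψ
      rw [dotProduct, Complex.re_sum] at this
      simp only [Pi.star_apply, Complex.star_def, Complex.conj_mul', Complex.one_re] at this
      rw [← this]
      refine Finset.sum_congr rfl fun t _ => ?_
      norm_cast
    rw [h2] at h1
    nlinarith [norm_nonneg (ψ s)]
  have hbound : ‖star ψ ⬝ᵥ A *ᵥ ψ‖ ≤ ∑ s, ∑ t, ‖A s t‖ := by
    rw [dotProduct]
    refine (norm_sum_le _ _).trans (Finset.sum_le_sum fun s _ => ?_)
    rw [Pi.star_apply, norm_mul, norm_star, mulVec, dotProduct]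
    refine (mul_le_of_le_one_left (norm_nonneg _) (hcomp s)).trans ?_
    refine (norm_sum_le _ _).trans (Finset.sum_le_sum fun t _ => ?_)
    rw [norm_mul]
    exact mul_le_of_le_one_right (norm_nonneg _) (hcomp t)
  have := Complex.abs_re_le_norm (star ψ ⬝ᵥ A *ᵥ ψ)
  rw [abs_le] at this
  linarith [this.1]

/-- The set of Rayleigh values of `A` on unit vectors of a sector `K` is bounded below.
Tasaki (2020) §2.1. [folklore] -/
theorem bddBelow_rayleighSet (A : Matrix n n ℂ) (K : Submodule ℂ (n → ℂ)) :
    BddBelow {E : ℝ | ∃ ψ ∈ K, star ψ ⬝ᵥ ψ = 1 ∧ E = (star ψ ⬝ᵥ A *ᵥ ψ).re} := by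
  refine ⟨-(∑ s, ∑ t, ‖A s t‖), ?_⟩
  rintro E ⟨ψ, -, hψ, rfl⟩
  exact neg_sum_norm_le_re_rayleigh A hψ

/-- **Variational principle in a sector**: `minEnergyOn A K ≤ re ⟨ψ, A ψ⟩` for every unit vector
`ψ ∈ K`. Tasaki (2020) §2.1, (2.1.6). [folklore] -/
theorem minEnergyOn_le_re_rayleigh (A : Matrix n n ℂ) (K : Submodule ℂ (n → ℂ)) {ψ : n → ℂ}
    (hψK : ψ ∈ K) (hψ : star ψ ⬝ᵥ ψ = 1) : A.minEnergyOn K ≤ (star ψ ⬝ᵥ A *ᵥ ψ).re :=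
  csInf_le (bddBelow_rayleighSet A K) ⟨ψ, hψK, hψ, rfl⟩

/-- **The chord inequality** (card `kappa-chord-transfer`, first lemma). For matrices `H`, `Y`, a
sector `K`, `κ > 0` and a unit vector `ψ ∈ K` of energy `re ⟨ψ, H ψ⟩ = minEnergyOn H K` (a sector
ground state), `(minEnergyOn (H + κ Y) K - minEnergyOn H K) / κ ≤ re ⟨ψ, Y ψ⟩`: the penalised
sector energy is at most `⟨ψ, (H + κ Y) ψ⟩ = minEnergyOn H K + κ re ⟨ψ, Y ψ⟩`. No hermiticity is
needed for this direction. [folklore] -/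
theorem chord_div_le_re_expect (H Y : Matrix n n ℂ) (K : Submodule ℂ (n → ℂ)) {κ : ℝ}
    (hκ : 0 < κ) {ψ : n → ℂ} (hψK : ψ ∈ K) (hψ : star ψ ⬝ᵥ ψ = 1)
    (hground : (star ψ ⬝ᵥ H *ᵥ ψ).re = H.minEnergyOn K) :
    ((H + (κ : ℂ) • Y).minEnergyOn K - H.minEnergyOn K) / κ ≤ (star ψ ⬝ᵥ Y *ᵥ ψ).re := by
  have h1 := minEnergyOn_le_re_rayleigh (H + (κ : ℂ) • Y) K hψK hψ
  rw [add_mulVec, dotProduct_add, Complex.add_re, smul_mulVec, dotProduct_smul,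
    smul_eq_mul, Complex.re_ofReal_mul, hground] at h1
  rw [div_le_iff₀ hκ]
  linarith

/-- The chord inequality for a sector ground state in the sense of an eigenvector:
`H ψ = minEnergyOn H K • ψ`, `ψ ∈ K` a unit vector. [folklore] -/
theorem chord_div_le_re_expect_of_eigen (H Y : Matrix n n ℂ) (K : Submodule ℂ (n → ℂ)) {κ : ℝ}
    (hκ : 0 < κ) {ψ : n → ℂ} (hψK : ψ ∈ K) (hψ : star ψ ⬝ᵥ ψ = 1)
    (heig : H *ᵥ ψ = ((H.minEnergyOn K : ℝ) : ℂ) • ψ) :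
    ((H + (κ : ℂ) • Y).minEnergyOn K - H.minEnergyOn K) / κ ≤ (star ψ ⬝ᵥ Y *ᵥ ψ).re := by
  refine chord_div_le_re_expect H Y K hκ hψK hψ ?_
  rw [heig, dotProduct_smul, hψ, smul_eq_mul, mul_one, Complex.ofReal_re]

end Variational

/-! ### Schur: irreducibility ⇒ scalar compression -/

section Schur

variable {n : Type*} [Fintype n] [DecidableEq n]

/-- **Schur's lemma (operator form).** Let `C` preserve the subspace `K` and commute ON `K` with
every member of a family `S` of operators preserving `K`. If `K` has no `S`-invariant subspace
other than `⊥` and `K` (irreducibility), then `C` acts on `K` as a scalar. Proof: an eigenspace of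
`C|_K` is a non-trivial `S`-invariant subspace of `K`.
Serre, *Linear Representations of Finite Groups*, §2.2 Prop. 4. [folklore] -/
theorem exists_scalar_of_irreducible (K : Submodule ℂ (n → ℂ)) (C : Matrix n n ℂ)
    (hCK : ∀ v ∈ K, C *ᵥ v ∈ K) (S : Set (Matrix n n ℂ)) (hSK : ∀ X ∈ S, ∀ v ∈ K, X *ᵥ v ∈ K)
    (hcomm : ∀ X ∈ S, ∀ v ∈ K, X *ᵥ (C *ᵥ v) = C *ᵥ (X *ᵥ v))
    (hirr : ∀ K' : Submodule ℂ (n → ℂ), K' ≤ K → (∀ X ∈ S, ∀ v ∈ K', X *ᵥ v ∈ K') →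
      K' = ⊥ ∨ K' = K) :
    ∃ μ : ℂ, ∀ v ∈ K, C *ᵥ v = μ • v := by
  by_cases hK : K = ⊥
  · refine ⟨0, fun v hv => ?_⟩
    rw [hK, Submodule.mem_bot] at hv
    simp [hv]
  -- the restriction of `C` to `K`
  let f : Module.End ℂ K := (Matrix.toLin' C).restrict (p := K) (q := K) fun v hv => hCK v hv
  have hf : ∀ u : K, ((f u : K) : n → ℂ) = C *ᵥ (u : n → ℂ) := fun u => by
    simp [f, LinearMap.restrict_apply]
  haveI : Nontrivial K := Submodule.nontrivial_iff_ne_bot.mpr hK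
  obtain ⟨μ, hμ⟩ := Module.End.exists_eigenvalue f
  refine ⟨μ, ?_⟩
  -- its `μ`-eigenspace, as a subspace of `n → ℂ`, is `S`-invariant and non-trivial
  let K' : Submodule ℂ (n → ℂ) := (Module.End.eigenspace f μ).map K.subtype
  have hmemK' : ∀ v : n → ℂ, v ∈ K' ↔ ∃ hv : v ∈ K, C *ᵥ v = μ • v := by
    intro v
    constructor
    · intro hv
      obtain ⟨u, hu, rfl⟩ := Submodule.mem_map.mp hv
      refine ⟨u.2, ?_⟩
      have h := Module.End.mem_eigenspace_iff.mp hu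
      have h' := congrArg Subtype.val h
      rw [hf u] at h'
      simpa using h'
    · rintro ⟨hv, hCv⟩
      refine Submodule.mem_map.mpr ⟨⟨v, hv⟩, ?_, rfl⟩
      rw [Module.End.mem_eigenspace_iff]
      apply Subtype.ext
      rw [hf]
      simpa using hCv
  have hK'le : K' ≤ K := fun v hv => ((hmemK' v).mp hv).1
  have hinv : ∀ X ∈ S, ∀ v ∈ K', X *ᵥ v ∈ K' := by
    intro X hX v hv
    obtain ⟨hvK, hCv⟩ := (hmemK' v).mp hv
    refine (hmemK' _).mpr ⟨hSK X hX v hvK, ?_⟩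
    rw [← hcomm X hX v hvK, hCv, mulVec_smul]
  have hne : K' ≠ ⊥ := by
    intro hbot
    have h1 : Module.End.eigenspace f μ = ⊥ := by
      rw [← Submodule.map_bot K.subtype] at hbot
      exact Submodule.map_injective_of_injective K.injective_subtype hbot
    exact (Module.End.hasEigenvalue_iff.mp hμ) h1
  rcases hirr K' hK'le hinv with h | h
  · exact absurd h hne
  · intro v hv
    rw [← h] at hv
    exact ((hmemK' v).mp hv).2

omit [DecidableEq n] in
/-- `⟨M w, u⟩ = ⟨w, Mᴴ u⟩` (adjoint). [folklore] -/
theorem star_mulVec_dotProduct (M : Matrix n n ℂ) (w u : n → ℂ) :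
    star (M *ᵥ w) ⬝ᵥ u = star w ⬝ᵥ Mᴴ *ᵥ u := by
  rw [star_mulVec, ← dotProduct_mulVec]

omit [DecidableEq n] in
/-- For a Hermitian matrix `P`, `⟨P w, u⟩ = ⟨w, P u⟩`. [folklore] -/
theorem star_mulVec_dotProduct_of_isHermitian {P : Matrix n n ℂ} (hP : P.IsHermitian)
    (w u : n → ℂ) : star (P *ᵥ w) ⬝ᵥ u = star w ⬝ᵥ P *ᵥ u := by
  rw [star_mulVec_dotProduct, hP.eq]

/-- The orthogonal projection matrix onto `K` is orthogonal: `⟨w, v - P v⟩ = 0` for `w ∈ K`.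
[folklore] -/
theorem star_dotProduct_sub_projMatrix_map_mulVec (K : Submodule ℂ (n → ℂ)) {w : n → ℂ}
    (hw : w ∈ K) (v : n → ℂ) :
    star w ⬝ᵥ (v - projMatrix (K.map ((WithLp.linearEquiv 2 ℂ (n → ℂ)).symm :
      (n → ℂ) →ₗ[ℂ] EuclideanSpace ℂ n)) *ᵥ v) = 0 := by
  set P := projMatrix (K.map ((WithLp.linearEquiv 2 ℂ (n → ℂ)).symm :
      (n → ℂ) →ₗ[ℂ] EuclideanSpace ℂ n)) with hP
  have hPw : P *ᵥ w = w := projMatrix_map_mulVec_of_mem K hw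
  rw [dotProduct_sub, ← star_mulVec_dotProduct_of_isHermitian (projMatrix_isHermitian _), hPw,
    sub_self]

/-- **Symmetries commute with the projection.** If `X` and `Xᴴ` both map `K` into `K`, then
`P_K (X v) = X (P_K v)` for every `v`. [folklore] -/
theorem projMatrix_map_mulVec_comm (K : Submodule ℂ (n → ℂ)) {X : Matrix n n ℂ}
    (hXK : ∀ v ∈ K, X *ᵥ v ∈ K) (hXK' : ∀ v ∈ K, Xᴴ *ᵥ v ∈ K) (v : n → ℂ) :
    projMatrix (K.map ((WithLp.linearEquiv 2 ℂ (n → ℂ)).symm :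
        (n → ℂ) →ₗ[ℂ] EuclideanSpace ℂ n)) *ᵥ (X *ᵥ v) =
      X *ᵥ (projMatrix (K.map ((WithLp.linearEquiv 2 ℂ (n → ℂ)).symm :
        (n → ℂ) →ₗ[ℂ] EuclideanSpace ℂ n)) *ᵥ v) := by
  set P := projMatrix (K.map ((WithLp.linearEquiv 2 ℂ (n → ℂ)).symm :
      (n → ℂ) →ₗ[ℂ] EuclideanSpace ℂ n)) with hP
  have hPH : P.IsHermitian := projMatrix_isHermitian _
  -- split `v = P v + (v - P v)`
  have hsplit : X *ᵥ v = X *ᵥ (P *ᵥ v) + X *ᵥ (v - P *ᵥ v) := by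
    rw [← mulVec_add, add_sub_cancel]
  have h1 : P *ᵥ (X *ᵥ (P *ᵥ v)) = X *ᵥ (P *ᵥ v) :=
    projMatrix_map_mulVec_of_mem K (hXK _ (projMatrix_map_mulVec_mem K v))
  -- the second piece is killed by `P`: its image lies in `K` and is orthogonal to `K`
  have h2 : P *ᵥ (X *ᵥ (v - P *ᵥ v)) = 0 := by
    set u := P *ᵥ (X *ᵥ (v - P *ᵥ v)) with hu
    have huK : u ∈ K := projMatrix_map_mulVec_mem K _
    have hPu : P *ᵥ u = u := projMatrix_map_mulVec_of_mem K huK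
    have horth : star u ⬝ᵥ u = 0 :=
      calc star u ⬝ᵥ u = star u ⬝ᵥ (P *ᵥ (X *ᵥ (v - P *ᵥ v))) := rfl
        _ = star (P *ᵥ u) ⬝ᵥ (X *ᵥ (v - P *ᵥ v)) :=
            (star_mulVec_dotProduct_of_isHermitian hPH _ _).symm
        _ = star u ⬝ᵥ (X *ᵥ (v - P *ᵥ v)) := by rw [hPu]
        _ = star (Xᴴ *ᵥ u) ⬝ᵥ (v - P *ᵥ v) := by
            have e := star_mulVec_dotProduct Xᴴ u (v - P *ᵥ v)
            rw [conjTranspose_conjTranspose] at e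
            exact e.symm
        _ = 0 := star_dotProduct_sub_projMatrix_map_mulVec K (hXK' u huK) v
    exact dotProduct_star_self_eq_zero.mp horth
  rw [hsplit, mulVec_add, h1, h2, add_zero]

/-- **Schur for the compression of a symmetric observable.** Let `A` be a matrix and `S` a family
of "symmetries": each `X ∈ S` commutes with `A` and both `X` and `Xᴴ` map the subspace `K` into
`K`. If `K` is irreducible under `S` (no `S`-invariant subspace strictly between `⊥` and `K`), then
the matrix elements of `A` on `K` are those of a scalar: `⟨w, A v⟩ = μ ⟨w, v⟩` for `v, w ∈ K`.
(Apply `exists_scalar_of_irreducible` to the compression `C = P_K A P_K`, which preserves `K` and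
commutes with `S` on `K` by `projMatrix_map_mulVec_comm`.) This is the Schur step of the intended
proof of `BirEveryGroundState` (the torus symmetry group acting on the sector ground eigenspace,
`A = Δ_d† Δ_d`). Serre, *Linear Representations of Finite Groups*, §2.2. [folklore] -/
theorem exists_scalar_matrixElements_of_irreducible (K : Submodule ℂ (n → ℂ)) (A : Matrix n n ℂ)
    (S : Set (Matrix n n ℂ)) (hSA : ∀ X ∈ S, X * A = A * X)
    (hSK : ∀ X ∈ S, ∀ v ∈ K, X *ᵥ v ∈ K) (hSK' : ∀ X ∈ S, ∀ v ∈ K, Xᴴ *ᵥ v ∈ K)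
    (hirr : ∀ K' : Submodule ℂ (n → ℂ), K' ≤ K → (∀ X ∈ S, ∀ v ∈ K', X *ᵥ v ∈ K') →
      K' = ⊥ ∨ K' = K) :
    ∃ μ : ℂ, ∀ v ∈ K, ∀ w ∈ K, star w ⬝ᵥ A *ᵥ v = μ * (star w ⬝ᵥ v) := by
  set P := projMatrix (K.map ((WithLp.linearEquiv 2 ℂ (n → ℂ)).symm :
      (n → ℂ) →ₗ[ℂ] EuclideanSpace ℂ n)) with hP
  have hPH : P.IsHermitian := projMatrix_isHermitian _
  -- the compression
  set C := P * A * P with hC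
  have hCv : ∀ v, C *ᵥ v = P *ᵥ (A *ᵥ (P *ᵥ v)) := fun v => by
    simp only [hC, ← mulVec_mulVec]
  have hCK : ∀ v ∈ K, C *ᵥ v ∈ K := fun v _ => by
    rw [hCv]
    exact projMatrix_map_mulVec_mem K _
  have hcomm : ∀ X ∈ S, ∀ v ∈ K, X *ᵥ (C *ᵥ v) = C *ᵥ (X *ᵥ v) := by
    intro X hX v _
    have hXA : ∀ w, X *ᵥ (A *ᵥ w) = A *ᵥ (X *ᵥ w) := fun w => by
      rw [mulVec_mulVec, mulVec_mulVec, hSA X hX]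
    calc X *ᵥ (C *ᵥ v) = X *ᵥ (P *ᵥ (A *ᵥ (P *ᵥ v))) := by rw [hCv]
      _ = P *ᵥ (X *ᵥ (A *ᵥ (P *ᵥ v))) :=
          (projMatrix_map_mulVec_comm K (hSK X hX) (hSK' X hX) _).symm
      _ = P *ᵥ (A *ᵥ (X *ᵥ (P *ᵥ v))) := by rw [hXA]
      _ = P *ᵥ (A *ᵥ (P *ᵥ (X *ᵥ v))) := by
          rw [projMatrix_map_mulVec_comm K (hSK X hX) (hSK' X hX)]
      _ = C *ᵥ (X *ᵥ v) := by rw [hCv]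
  obtain ⟨μ, hμ⟩ := exists_scalar_of_irreducible K C hCK S hSK hcomm hirr
  refine ⟨μ, fun v hv w hw => ?_⟩
  have hPv : P *ᵥ v = v := projMatrix_map_mulVec_of_mem K hv
  have hPw : P *ᵥ w = w := projMatrix_map_mulVec_of_mem K hw
  calc star w ⬝ᵥ A *ᵥ v = star (P *ᵥ w) ⬝ᵥ A *ᵥ (P *ᵥ v) := by rw [hPv, hPw]
    _ = star w ⬝ᵥ C *ᵥ v := by rw [hCv, star_mulVec_dotProduct_of_isHermitian hPH]
    _ = μ * (star w ⬝ᵥ v) := by rw [hμ v hv, dotProduct_smul, smul_eq_mul]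

end Schur

/-! ### Countably many countable bad sets of couplings miss a point of every window -/

/-- If each `B L ⊆ ℝ` is countable, every non-degenerate open interval contains a point outside
all of them (an open real interval is uncountable). The coupling-choice step of average → every:
per side `L`, the exceptional couplings are finitely (or countably) many. [folklore] -/
theorem exists_mem_Ioo_forall_not_mem {U₁ U₂ : ℝ} (h : U₁ < U₂) (B : ℕ → Set ℝ)
    (hB : ∀ L, (B L).Countable) : ∃ U ∈ Set.Ioo U₁ U₂, ∀ L, U ∉ B L := by
  by_contra hcon
  push Not at hcon
  have hsub : Set.Ioo U₁ U₂ ⊆ ⋃ L, B L := fun U hU => by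
    obtain ⟨L, hL⟩ := hcon U hU
    exact Set.mem_iUnion.mpr ⟨L, hL⟩
  have hc : (Set.Ioo U₁ U₂).Countable := (Set.countable_iUnion hB).mono hsub
  have h1 : Cardinal.mk (Set.Ioo U₁ U₂) ≤ Cardinal.aleph0 := Cardinal.mk_le_aleph0_iff.2 hc.to_subtype
  rw [Cardinal.mk_Ioo_real h] at h1
  exact not_le_of_gt Cardinal.aleph0_lt_continuum h1

end Summit.HubbardSuperconductivity.HubbardSuperconductivity.Theorems
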